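import Summits.Parity.GeneralizedHardyLittlewood.Theorems.LeeYangFibresRelativeDimOnePairRigidityDecayTools
import HarnessLib

/-!
# Route `LeeYangFibres`, crux `RelativeDimOne` (stmt-Parity-14113), line `gallagher-backwards-split`:
# reshaped pair-slice rigidity — part 2, the MAIN TERM and the TAIL

Two estimates for a level-`Q` spectrum `x` with Hardy–Littlewood decay `|x_d| ≤ C/φ(d)`
(notation of part 1, `…PairRigidityDecayTools`):

* MAIN TERM (`abs_densAvg_sub_divSum_le`): for `q = h₁P′` (`h₁, P′` coprime, every prime `≤ w₀`
  dividing `q`) and `r ≡ 0 (h₁)`, `r ≡ 1 (P′)` — so `gcd(q,r) = h₁` (`gcd_eq_of_crt`) and the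
  indicator `[gcd(d,q) ∣ r]` is `[d ⊥ P′]` (`gcd_dvd_iff_coprime`) — the density average differs from
  `F(h₁)` by a sum over `d = d₁d₂`, `d₁ ∣ h₁`, `d₂ > 1` `w₀`-ROUGH, weighted `x_d/d₂`; with squarefree
  support and decay, `|Φ_q(r) − F(h₁)| ≤ C·G(h₁)·(2/w₀)`.
* TAIL (`abs_divSum_prod_sub_le`, `phiDivSum_prod_large_primes_le`): splitting a product of distinct
  primes at `w′`, `|F(h₁h₂) − F(h₁)| ≤ C·G(h₁)·(G(h₂) − 1)` and `G(h₂) ≤ exp(#{p ∣ h₂}/w′)` when all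
  primes of `h₂` exceed `w′`.

The assembly (`pairRigidityWithDecay`) is part 3.  See `Cruxes/RelativeDimOne/StubRigidityFalse-c1.md` §7.
-/

noncomputable section

open scoped BigOperators
open Finset Real

namespace Summit.Parity.GeneralizedHardyLittlewood.Cruxes.RelativeDimOne.RigidityC1

/-! ### The main term: `Φ_q(r)` versus `F(h₁)` for `q = h₁ P′`, `gcd(q,r) = h₁` -/

/-- For `q = h₁ P′` with `h₁, P′` coprime, `h₁ ∣ r` and `r ≡ 1 [MOD P′]`: `gcd(q, r) = h₁`. -/
theorem gcd_eq_of_crt {h₁ P' r : ℕ} (hcop : Nat.Coprime h₁ P') (hr1 : h₁ ∣ r) (hr2 : r ≡ 1 [MOD P']) :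
    Nat.gcd (h₁ * P') r = h₁ := by
  rw [Nat.gcd_comm, Nat.Coprime.gcd_mul r hcop]
  have e1 : Nat.gcd r h₁ = h₁ := Nat.gcd_eq_right hr1
  have e2 : Nat.gcd r P' = 1 := by
    rw [hr2.gcd_eq]
    simp
  rw [e1, e2, mul_one]

/-- For `d` coprime to `P′`: `gcd(d, h₁ P′) = gcd(d, h₁)`. -/
theorem gcd_mul_eq_of_coprime {d h₁ P' : ℕ} (hd : Nat.Coprime d P') :
    Nat.gcd d (h₁ * P') = Nat.gcd d h₁ :=
  Nat.Coprime.gcd_mul_right_cancel_right h₁ hd.symm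

/-- The indicator in `Φ_q(r)`: for `q = h₁P′`, `gcd(q,r) = h₁`, one has
`gcd(d,q) ∣ r ↔ d` coprime to `P′`. -/
theorem gcd_dvd_iff_coprime {d h₁ P' r : ℕ} (hcop : Nat.Coprime h₁ P') (hr1 : h₁ ∣ r)
    (hr2 : r ≡ 1 [MOD P']) : Nat.gcd d (h₁ * P') ∣ r ↔ Nat.Coprime d P' := by
  constructor
  · intro h
    have hg : Nat.gcd d (h₁ * P') ∣ h₁ := by
      have h2 : Nat.gcd d (h₁ * P') ∣ Nat.gcd (h₁ * P') r :=
        Nat.dvd_gcd (Nat.gcd_dvd_right _ _) h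
      rwa [gcd_eq_of_crt hcop hr1 hr2] at h2
    -- `gcd(d, P') ∣ gcd(d, h₁P') ∣ h₁` and `∣ P'`, hence `∣ gcd(h₁, P') = 1`
    have h3 : Nat.gcd d P' ∣ Nat.gcd d (h₁ * P') :=
      Nat.gcd_dvd_gcd_of_dvd_right _ (Dvd.intro_left _ rfl)
    have h4 : Nat.gcd d P' ∣ Nat.gcd h₁ P' := Nat.dvd_gcd (h3.trans hg) (Nat.gcd_dvd_right _ _)
    rw [Nat.Coprime.gcd_eq_one hcop] at h4
    exact Nat.coprime_iff_gcd_eq_one.mpr (Nat.eq_one_of_dvd_one h4)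
  · intro hd
    rw [gcd_mul_eq_of_coprime hd]
    exact (Nat.gcd_dvd_right d h₁).trans hr1

/-- THE MAIN-TERM BOUND.  Let `h₁ ≠ 0`, `P′` coprime to `h₁`, `q = h₁ P′`, and `r` with `h₁ ∣ r`,
`r ≡ 1 [MOD P′]`; assume every prime `p ≤ w₀` divides `q`.  For a spectrum `x` supported on squarefree
`d ∈ [1, Q]` with `|x_d| ≤ C/φ(d)`:
`|Φ_q(r) − F(h₁)| ≤ C · G(h₁) · (2/w₀)` — the difference is a sum over divisors `d = d₁ d₂` with
`d₁ ∣ h₁` and a `w₀`-ROUGH cofactor `d₂ > 1`, weighted `x_d / d₂`. -/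
theorem abs_densAvg_sub_divSum_le {Q w₀ h₁ P' r : ℕ} {C : ℝ} {x : ℕ → ℝ} (hC : 0 ≤ C)
    (hw₀ : 1 ≤ w₀) (hh₁ : h₁ ≠ 0) (hcop : Nat.Coprime h₁ P') (hr1 : h₁ ∣ r) (hr2 : r ≡ 1 [MOD P'])
    (hcover : ∀ p : ℕ, p.Prime → p ≤ w₀ → p ∣ h₁ * P')
    (hsupp : ∀ d, x d ≠ 0 → Squarefree d ∧ 1 ≤ d ∧ d ≤ Q) (hdec : ∀ d, |x d| ≤ C / Nat.totient d) :
    |densAvg Q x (h₁ * P') r - divSum x h₁| ≤ C * phiDivSum h₁ * (2 / w₀) := by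
  classical
  -- Step 1: rewrite `Φ` with the simplified weight `w(d) = [Coprime d P'] / (d / gcd(d,h₁))`.
  set wt : ℕ → ℝ := fun d => if Nat.Coprime d P' then (1 : ℝ) / ((d / Nat.gcd d h₁ : ℕ) : ℝ) else 0
    with hwt
  have hΦ : densAvg Q x (h₁ * P') r = ∑ d ∈ Icc 1 Q, x d * wt d := by
    unfold densAvg
    refine Finset.sum_congr rfl fun d hd => ?_
    have hd1 : 1 ≤ d := (Finset.mem_Icc.1 hd).1
    by_cases hc : Nat.Coprime d P'
    · have hdiv : Nat.gcd d (h₁ * P') ∣ r := (gcd_dvd_iff_coprime hcop hr1 hr2).2 hc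
      have hwt_d : wt d = 1 / ((d / Nat.gcd d h₁ : ℕ) : ℝ) := by simp [hwt, hc]
      rw [if_pos hdiv, mul_one, hwt_d, gcd_mul_eq_of_coprime hc]
      congr 1
      -- `gcd(d,h₁)/d = 1/(d/gcd(d,h₁))`
      have hg0 : 0 < Nat.gcd d h₁ := Nat.gcd_pos_of_pos_left _ hd1
      have hgd : Nat.gcd d h₁ ∣ d := Nat.gcd_dvd_left d h₁
      have hde : (Nat.gcd d h₁ : ℝ) * ((d / Nat.gcd d h₁ : ℕ) : ℝ) = d := by
        rw [← Nat.cast_mul, Nat.mul_div_cancel' hgd]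
      have hg0' : (0 : ℝ) < Nat.gcd d h₁ := by exact_mod_cast hg0
      have he0' : (0 : ℝ) < ((d / Nat.gcd d h₁ : ℕ) : ℝ) := by
        have : 0 < d / Nat.gcd d h₁ := Nat.div_pos (Nat.le_of_dvd hd1 hgd) hg0
        exact_mod_cast this
      rw [← hde]
      field_simp
    · have hndiv : ¬ Nat.gcd d (h₁ * P') ∣ r := fun h => hc ((gcd_dvd_iff_coprime hcop hr1 hr2).1 h)
      rw [if_neg hndiv, hwt]
      simp [if_neg hc]
  -- Step 2: `F(h₁) = Σ_{d ∈ Icc 1 Q, d ∣ h₁} x d`, and for `d ∣ h₁` the weight is `1`.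
  have hF : divSum x h₁ = ∑ d ∈ (Icc 1 Q).filter (· ∣ h₁), x d := by
    unfold divSum
    -- both are the sum of `x` over `{d ∣ h₁ : d ≤ Q}`, other divisors carry `x d = 0`
    have hsub : (Icc 1 Q).filter (· ∣ h₁) ⊆ h₁.divisors := by
      intro d hd
      rw [Finset.mem_filter] at hd
      exact Nat.mem_divisors.2 ⟨hd.2, hh₁⟩
    rw [← Finset.sum_subset hsub]
    intro d hd hnot
    by_contra hx
    have := hsupp d hx
    apply hnot
    rw [Finset.mem_filter, Finset.mem_Icc]
    exact ⟨⟨this.2.1, this.2.2⟩, Nat.dvd_of_mem_divisors hd⟩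
  have hwt_dvd : ∀ d, d ∣ h₁ → wt d = 1 := by
    intro d hd
    have hc : Nat.Coprime d P' := Nat.Coprime.coprime_dvd_left hd hcop
    rw [hwt]
    simp only [if_pos hc]
    rw [Nat.gcd_eq_left hd]
    have hd0 : 0 < d := Nat.pos_of_dvd_of_pos hd (Nat.pos_of_ne_zero hh₁)
    rw [Nat.div_self hd0]
    simp
  -- Step 3: the difference is the sum over `d ∤ h₁`.
  have hdiff : densAvg Q x (h₁ * P') r - divSum x h₁ =
      ∑ d ∈ (Icc 1 Q).filter (fun d => ¬ d ∣ h₁), x d * wt d := by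
    rw [hΦ, hF, ← Finset.sum_filter_add_sum_filter_not (Icc 1 Q) (· ∣ h₁)]
    have : ∑ d ∈ (Icc 1 Q).filter (· ∣ h₁), x d * wt d = ∑ d ∈ (Icc 1 Q).filter (· ∣ h₁), x d := by
      refine Finset.sum_congr rfl fun d hd => ?_
      rw [hwt_dvd d (Finset.mem_filter.1 hd).2, mul_one]
    rw [this]
    ring
  rw [hdiff]
  -- Step 4: bound termwise; only squarefree `d` coprime to `P'` contribute.
  set S := ((Icc 1 Q).filter (fun d => ¬ d ∣ h₁)).filter (fun d => Squarefree d ∧ Nat.Coprime d P')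
    with hS
  have hstep : |∑ d ∈ (Icc 1 Q).filter (fun d => ¬ d ∣ h₁), x d * wt d| ≤
      ∑ d ∈ S, C / Nat.totient d * ((1 : ℝ) / ((d / Nat.gcd d h₁ : ℕ) : ℝ)) := by
    refine (Finset.abs_sum_le_sum_abs _ _).trans ?_
    rw [show (∑ d ∈ S, C / Nat.totient d * ((1 : ℝ) / ((d / Nat.gcd d h₁ : ℕ) : ℝ))) =
        ∑ d ∈ (Icc 1 Q).filter (fun d => ¬ d ∣ h₁),
          (if Squarefree d ∧ Nat.Coprime d P' then C / Nat.totient d * ((1 : ℝ) / ((d / Nat.gcd d h₁ : ℕ) : ℝ))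
            else 0) from by rw [hS, Finset.sum_filter]]
    refine Finset.sum_le_sum fun d hd => ?_
    by_cases hgood : Squarefree d ∧ Nat.Coprime d P'
    · rw [if_pos hgood, hwt]
      simp only [if_pos hgood.2]
      rw [abs_mul, abs_of_nonneg (by positivity : (0 : ℝ) ≤ 1 / ((d / Nat.gcd d h₁ : ℕ) : ℝ))]
      exact mul_le_mul_of_nonneg_right (hdec d) (by positivity)
    · rw [if_neg hgood]
      -- then `x d * wt d = 0`
      have : x d * wt d = 0 := by
        by_cases hc : Nat.Coprime d P'
        · have hx : x d = 0 := by
            by_contra hx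
            exact hgood ⟨(hsupp d hx).1, hc⟩
          rw [hx, zero_mul]
        · rw [hwt]
          simp [if_neg hc]
      rw [this, abs_zero]
  refine hstep.trans ?_
  -- Step 5: reindex `d ↦ (gcd(d,h₁), d / gcd(d,h₁))` into `h₁.divisors × (rough divisors ≠ 1)`.
  set T := (roughPrimorial w₀ Q).divisors.erase 1 with hT
  set ι : ℕ → ℕ × ℕ := fun d => (Nat.gcd d h₁, d / Nat.gcd d h₁) with hι
  have hι_inj : Set.InjOn ι S := by
    intro a _ b _ hab
    simp only [hι, Prod.mk.injEq] at hab
    have ha : a = Nat.gcd a h₁ * (a / Nat.gcd a h₁) :=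
      (Nat.mul_div_cancel' (Nat.gcd_dvd_left a h₁)).symm
    have hb : b = Nat.gcd b h₁ * (b / Nat.gcd b h₁) :=
      (Nat.mul_div_cancel' (Nat.gcd_dvd_left b h₁)).symm
    calc a = Nat.gcd a h₁ * (a / Nat.gcd a h₁) := ha
      _ = Nat.gcd b h₁ * (b / Nat.gcd b h₁) := by rw [hab.2, hab.1]
      _ = b := hb.symm
  have hι_maps : ∀ d ∈ S, ι d ∈ h₁.divisors ×ˢ T := by
    intro d hd
    rw [hS, Finset.mem_filter, Finset.mem_filter, Finset.mem_Icc] at hd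
    obtain ⟨⟨⟨hd1, hdQ⟩, hndvd⟩, hsq, hcP⟩ := hd
    set d₁ := Nat.gcd d h₁ with hd₁
    set d₂ := d / Nat.gcd d h₁ with hd₂
    have hdd : d = d₁ * d₂ := (Nat.mul_div_cancel' (Nat.gcd_dvd_left d h₁)).symm
    have hsq2 : Squarefree (d₁ * d₂) := hdd ▸ hsq
    have hcop12 : Nat.Coprime d₁ d₂ := Nat.coprime_of_squarefree_mul hsq2
    have hsqd₂ : Squarefree d₂ := hsq2.of_mul_right
    have hmem1 : d₁ ∈ h₁.divisors := Nat.mem_divisors.2 ⟨Nat.gcd_dvd_right d h₁, hh₁⟩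
    have hmem2 : d₂ ∈ T := by
      rw [hT, Finset.mem_erase]
      constructor
      · -- `d₂ ≠ 1` since `d ∤ h₁`
        intro h1
        apply hndvd
        rw [hdd, h1, mul_one]
        exact Nat.gcd_dvd_right d h₁
      · rw [Nat.mem_divisors]
        refine ⟨?_, (roughPrimorial_pos w₀ Q).ne'⟩
        -- `d₂ = Π primeFactors d₂` and every prime factor lies in `(w₀, Q]`
        rw [← Nat.prod_primeFactors_of_squarefree hsqd₂]
        unfold roughPrimorial
        refine Finset.prod_dvd_prod_of_subset _ _ _ fun p hp => ?_
        have hpp : p.Prime := Nat.prime_of_mem_primeFactors hp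
        have hpd₂ : p ∣ d₂ := Nat.dvd_of_mem_primeFactors hp
        have hpd : p ∣ d := hpd₂.trans (hdd ▸ Dvd.intro_left _ rfl)
        rw [Finset.mem_filter, Finset.mem_Ioc]
        refine ⟨⟨?_, ?_⟩, hpp⟩
        · -- `p > w₀`: otherwise `p ∣ h₁ P'`, so `p ∣ h₁` (then `p ∣ d₁`, contradicting coprimality with `d₂`) or `p ∣ P'`
          by_contra hle
          push Not at hle
          have hpq : p ∣ h₁ * P' := hcover p hpp (by omega)
          rcases (Nat.Prime.dvd_mul hpp).1 hpq with hph | hpP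
          · have hpd₁ : p ∣ d₁ := Nat.dvd_gcd hpd hph
            have : p ∣ Nat.gcd d₁ d₂ := Nat.dvd_gcd hpd₁ hpd₂
            rw [Nat.Coprime.gcd_eq_one hcop12] at this
            exact hpp.one_lt.ne' (Nat.dvd_one.1 this)
          · have : p ∣ Nat.gcd d P' := Nat.dvd_gcd hpd hpP
            rw [Nat.Coprime.gcd_eq_one hcP] at this
            exact hpp.one_lt.ne' (Nat.dvd_one.1 this)
        · exact (Nat.le_of_dvd (by omega) hpd).trans hdQ
    exact Finset.mem_product.2 ⟨hmem1, hmem2⟩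
  -- the summand as a function of `ι d`
  have hterm : ∀ d ∈ S, C / Nat.totient d * ((1 : ℝ) / ((d / Nat.gcd d h₁ : ℕ) : ℝ)) =
      C * ((1 : ℝ) / Nat.totient (ι d).1 * ((1 : ℝ) / (((ι d).2 : ℝ) * Nat.totient (ι d).2))) := by
    intro d hd
    rw [hS, Finset.mem_filter, Finset.mem_filter, Finset.mem_Icc] at hd
    obtain ⟨⟨⟨hd1, _⟩, _⟩, hsq, _⟩ := hd
    show C / Nat.totient d * ((1 : ℝ) / ((d / Nat.gcd d h₁ : ℕ) : ℝ)) =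
      C * ((1 : ℝ) / Nat.totient (Nat.gcd d h₁) *
        ((1 : ℝ) / (((d / Nat.gcd d h₁ : ℕ) : ℝ) * Nat.totient (d / Nat.gcd d h₁))))
    have hdd : d = Nat.gcd d h₁ * (d / Nat.gcd d h₁) :=
      (Nat.mul_div_cancel' (Nat.gcd_dvd_left d h₁)).symm
    have hsq2 : Squarefree (Nat.gcd d h₁ * (d / Nat.gcd d h₁)) := hdd ▸ hsq
    have hcop12 : Nat.Coprime (Nat.gcd d h₁) (d / Nat.gcd d h₁) := Nat.coprime_of_squarefree_mul hsq2
    have htot : (Nat.totient d : ℝ) = Nat.totient (Nat.gcd d h₁) * Nat.totient (d / Nat.gcd d h₁) := by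
      conv_lhs => rw [hdd]
      rw [Nat.totient_mul hcop12, Nat.cast_mul]
    have hg0 : 0 < Nat.gcd d h₁ := Nat.gcd_pos_of_pos_left _ hd1
    have he0 : 0 < d / Nat.gcd d h₁ := Nat.div_pos (Nat.le_of_dvd hd1 (Nat.gcd_dvd_left d h₁)) hg0
    have h1 : (0 : ℝ) < Nat.totient (Nat.gcd d h₁) := by exact_mod_cast Nat.totient_pos.2 hg0
    have h2 : (0 : ℝ) < Nat.totient (d / Nat.gcd d h₁) := by exact_mod_cast Nat.totient_pos.2 he0
    have h3 : (0 : ℝ) < ((d / Nat.gcd d h₁ : ℕ) : ℝ) := by exact_mod_cast he0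
    rw [htot]
    field_simp
  calc ∑ d ∈ S, C / Nat.totient d * ((1 : ℝ) / ((d / Nat.gcd d h₁ : ℕ) : ℝ))
      = ∑ d ∈ S, C * ((1 : ℝ) / Nat.totient (ι d).1 *
          ((1 : ℝ) / (((ι d).2 : ℝ) * Nat.totient (ι d).2))) := Finset.sum_congr rfl hterm
    _ = C * ∑ d ∈ S, ((1 : ℝ) / Nat.totient (ι d).1 *
          ((1 : ℝ) / (((ι d).2 : ℝ) * Nat.totient (ι d).2))) := by rw [Finset.mul_sum]
    _ = C * ∑ y ∈ S.image ι, ((1 : ℝ) / Nat.totient y.1 * ((1 : ℝ) / ((y.2 : ℝ) * Nat.totient y.2))) := by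
          rw [Finset.sum_image hι_inj]
    _ ≤ C * ∑ y ∈ h₁.divisors ×ˢ T, ((1 : ℝ) / Nat.totient y.1 * ((1 : ℝ) / ((y.2 : ℝ) * Nat.totient y.2))) := by
          refine mul_le_mul_of_nonneg_left ?_ hC
          refine Finset.sum_le_sum_of_subset_of_nonneg ?_ fun y _ _ => by positivity
          intro y hy
          rw [Finset.mem_image] at hy
          obtain ⟨d, hd, rfl⟩ := hy
          exact hι_maps d hd
    _ = C * ((∑ d₁ ∈ h₁.divisors, (1 : ℝ) / Nat.totient d₁) *
          ∑ d₂ ∈ T, (1 : ℝ) / ((d₂ : ℝ) * Nat.totient d₂)) := by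
          rw [Finset.sum_product, Finset.sum_mul_sum]
    _ ≤ C * (phiDivSum h₁ * (2 / w₀)) := by
          refine mul_le_mul_of_nonneg_left ?_ hC
          refine mul_le_mul_of_nonneg_left (sum_rough_divisors_le hw₀ Q) (phiDivSum_nonneg h₁)
    _ = C * phiDivSum h₁ * (2 / w₀) := by ring

/-! ### The tail: divisors carrying a prime above `w′` -/

/-- Splitting a product of distinct primes at `w′`: with `h₁ = Π{p ∈ P : p ≤ w′}`,
`h₂ = Π{p ∈ P : p > w′}`, one has `|F(h₁h₂) − F(h₁)| ≤ C·G(h₁)·(G(h₂) − 1)` for any spectrum with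
`|x_d| ≤ C/φ(d)`. -/
theorem abs_divSum_prod_sub_le {C : ℝ} {x : ℕ → ℝ} (hdec : ∀ d, |x d| ≤ C / Nat.totient d)
    (P : Finset ℕ) (hP : ∀ p ∈ P, p.Prime) (w' : ℕ) :
    |divSum x ((∏ p ∈ P.filter (· ≤ w'), p) * ∏ p ∈ P.filter (fun p => ¬ p ≤ w'), p) -
        divSum x (∏ p ∈ P.filter (· ≤ w'), p)| ≤
      C * phiDivSum (∏ p ∈ P.filter (· ≤ w'), p) *
        (phiDivSum (∏ p ∈ P.filter (fun p => ¬ p ≤ w'), p) - 1) := by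
  classical
  set h₁ := ∏ p ∈ P.filter (· ≤ w'), p with hh₁
  set h₂ := ∏ p ∈ P.filter (fun p => ¬ p ≤ w'), p with hh₂
  have hcop : Nat.Coprime h₁ h₂ := by
    rw [hh₁, hh₂]
    refine Nat.Coprime.prod_left fun p hp => Nat.Coprime.prod_right fun q hq => ?_
    have hp' := Finset.mem_filter.1 hp
    have hq' := Finset.mem_filter.1 hq
    have hne : p ≠ q := fun h => hq'.2 (h ▸ hp'.2)
    exact (Nat.coprime_primes (hP p hp'.1) (hP q hq'.1)).2 hne
  have hh₁0 : h₁ ≠ 0 := Finset.prod_ne_zero_iff.2 fun p hp => (hP p (Finset.mem_filter.1 hp).1).ne_zero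
  have hh₂0 : h₂ ≠ 0 := Finset.prod_ne_zero_iff.2 fun p hp => (hP p (Finset.mem_filter.1 hp).1).ne_zero
  have h1mem : (1 : ℕ) ∈ h₂.divisors := Nat.one_mem_divisors.2 hh₂0
  -- expand `F(h₁ h₂)` and split off `b = 1`
  have hexp : divSum x (h₁ * h₂) =
      divSum x h₁ + ∑ a ∈ h₁.divisors, ∑ b ∈ h₂.divisors.erase 1, x (a * b) := by
    unfold divSum
    rw [Literature.NumberTheory.Sieve.sum_divisors_mul_of_coprime hcop]
    rw [← Finset.sum_add_distrib]
    refine Finset.sum_congr rfl fun a _ => ?_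
    rw [← Finset.add_sum_erase _ _ h1mem, mul_one]
  rw [hexp, add_sub_cancel_left]
  -- bound termwise
  have hG₂ : phiDivSum h₂ - 1 = ∑ b ∈ h₂.divisors.erase 1, (1 : ℝ) / Nat.totient b := by
    unfold phiDivSum
    rw [← Finset.add_sum_erase _ _ h1mem]
    simp
  calc |∑ a ∈ h₁.divisors, ∑ b ∈ h₂.divisors.erase 1, x (a * b)|
      ≤ ∑ a ∈ h₁.divisors, |∑ b ∈ h₂.divisors.erase 1, x (a * b)| := Finset.abs_sum_le_sum_abs _ _
    _ ≤ ∑ a ∈ h₁.divisors, ∑ b ∈ h₂.divisors.erase 1, |x (a * b)| :=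
        Finset.sum_le_sum fun a _ => Finset.abs_sum_le_sum_abs _ _
    _ ≤ ∑ a ∈ h₁.divisors, ∑ b ∈ h₂.divisors.erase 1,
          C * ((1 : ℝ) / Nat.totient a * ((1 : ℝ) / Nat.totient b)) := by
        refine Finset.sum_le_sum fun a ha => Finset.sum_le_sum fun b hb => ?_
        have hadvd : a ∣ h₁ := Nat.dvd_of_mem_divisors ha
        have hbdvd : b ∣ h₂ := Nat.dvd_of_mem_divisors (Finset.mem_of_mem_erase hb)
        have hab : Nat.Coprime a b :=
          Nat.Coprime.coprime_dvd_left hadvd (Nat.Coprime.coprime_dvd_right hbdvd hcop)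
        refine (hdec (a * b)).trans (le_of_eq ?_)
        rw [Nat.totient_mul hab, Nat.cast_mul, one_div_mul_one_div, ← div_eq_mul_one_div]
    _ = C * phiDivSum h₁ * (phiDivSum h₂ - 1) := by
        rw [hG₂]
        unfold phiDivSum
        rw [mul_assoc, Finset.sum_mul_sum, Finset.mul_sum]
        refine Finset.sum_congr rfl fun a _ => ?_
        rw [Finset.mul_sum]

/-- For primes all exceeding `w′ ≥ 1`: `G(Π P₂) ≤ exp(#P₂ / w′)`. -/
theorem phiDivSum_prod_large_primes_le (P₂ : Finset ℕ) (hP : ∀ p ∈ P₂, p.Prime) {w' : ℕ} (hw' : 1 ≤ w')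
    (hlarge : ∀ p ∈ P₂, w' < p) :
    phiDivSum (∏ p ∈ P₂, p) ≤ Real.exp ((P₂.card : ℝ) / w') := by
  rw [phiDivSum_prod_primes P₂ hP]
  have hw0 : (0 : ℝ) < w' := by exact_mod_cast hw'
  calc ∏ p ∈ P₂, (1 + 1 / ((p : ℝ) - 1)) ≤ ∏ _p ∈ P₂, Real.exp (1 / (w' : ℝ)) := by
        refine Finset.prod_le_prod (fun p hp => ?_) (fun p hp => ?_)
        · have : (2 : ℝ) ≤ p := by exact_mod_cast (hP p hp).two_le
          have : (0 : ℝ) ≤ 1 / ((p : ℝ) - 1) := by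
            apply div_nonneg zero_le_one; linarith
          linarith
        · have hp1 : (w' : ℝ) ≤ (p : ℝ) - 1 := by
            have : w' + 1 ≤ p := hlarge p hp
            have : ((w' + 1 : ℕ) : ℝ) ≤ p := by exact_mod_cast this
            push_cast at this
            linarith
          have h1 : 1 / ((p : ℝ) - 1) ≤ 1 / (w' : ℝ) :=
            one_div_le_one_div_of_le hw0 hp1
          have h2 := Real.add_one_le_exp (1 / (w' : ℝ))
          linarith
    _ = Real.exp ((P₂.card : ℝ) / w') := by
        rw [Finset.prod_const, ← Real.exp_nat_mul]
        congr 1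
        ring


/-- Registered hook (stmt-Parity-14113, seat c1): the main-term bound, `∀`-form of
`abs_densAvg_sub_divSum_le`. -/
theorem mainTermHook : ∀ (Q w₀ h₁ P' r : ℕ) (C : ℝ) (x : ℕ → ℝ), 0 ≤ C → 1 ≤ w₀ → h₁ ≠ 0 →
    Nat.Coprime h₁ P' → h₁ ∣ r → r ≡ 1 [MOD P'] →
    (∀ p : ℕ, p.Prime → p ≤ w₀ → p ∣ h₁ * P') →
    (∀ d, x d ≠ 0 → Squarefree d ∧ 1 ≤ d ∧ d ≤ Q) → (∀ d, |x d| ≤ C / Nat.totient d) →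
    |densAvg Q x (h₁ * P') r - divSum x h₁| ≤ C * phiDivSum h₁ * (2 / w₀) :=
  fun _ _ _ _ _ _ _ hC hw₀ hh₁ hcop hr1 hr2 hcover hsupp hdec =>
    abs_densAvg_sub_divSum_le hC hw₀ hh₁ hcop hr1 hr2 hcover hsupp hdec

end Summit.Parity.GeneralizedHardyLittlewood.Cruxes.RelativeDimOne.RigidityC1
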